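import Literature.MathematicalPhysics.QuantumFieldTheory.Balaban1983to89.B9Eq382FormRelativeNearFlatTower

/-!
# `Balaban1983to89.B9Thm311SmallFieldCoercivityTowerScaled` — T. Bałaban, *Propagators for lattice gauge theories in a background field*, Commun. Math.
# Phys. **99** (1985) 389–434 [Balaban1985BackgroundPropagators] Thm 3.11 p. 416 with (3.35) p. 396 (the η-SCALED small-field class) and (3.82)–(3.86)
# p. 407, [Balaban1984PropagatorsI] Prop. 1.1 (1.90) p. 33 «γ₀ independent of k»: THE SECOND HALF OF THM 3.11 FOR THE `(n+1)`-LEVEL OPERATOR OF THE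
# pub-balaban NE9 CHAIN WITH `∃ α₀ γ′` BEFORE `∀ L ∀ n ∀ η ∀ c₀ c₁ ∀ m ∀ U` — IN PRINT's SCALED CURRENCY AND MODULO THE TWO DISPLAYED LIPSCHITZ LETTERS
# `‖R_{n+1}(U) − R_{n+1}(1)‖ ≤ C_R·α`, `‖Q_{n+1}(U) − Q_{n+1}(1)‖ ≤ C_Q·α`: `(γ(d,a)∕2)·(‖D(1)x‖² + ‖D*(1)x‖² + ‖x‖²) ≤ re⟨x, Δ^{(n+1)}_a(U)x⟩` whenever
# `α ≤ α₀(d, a, K_R, C_R, C_Q, M_Q)` — ne9-leaf-03's `B9Thm311SmallFieldCoercivityScaled` ONE STOREY UP, SAME CLOSED FORMS, NO DEPENDENCE ON THE NUMBER OF LEVELS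

statement-level skeleton of published theorems with citation tags; proofs where landed; nothing here is a claim about the Yang–Mills mass gap

PDF held: `paper:balaban1985-cmp99-background-propagators` p. 396 ((3.35)), p. 416 (Thm 3.11); [B5] p. 33 — via the tree's `B9Thm311SmallFieldCoercivityScaled`
∕ `B5Eq190FlatStrongFormTransfer` quotations (verbatim there).

WHY THIS FILE (cell context).  `B9Eq382FormRelativeNearFlatTower` (this lineage, gen 84) gives the form-relative near-flat step for the `(n+1)`-level operator
with the explicit, level-free flat constant γ(d,a) (`B9Eq326OperatorTowerFlatExplicit` ∕ `B9Eq316TowerFlatIsOneStep`).  THIS FILE closes it exactly as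
ne9-leaf-03 closed the one-step case: with the `R`- and `Q`-letters DISPLAYED in α-currency, `α₀` and `γ′ = γ(d,a)∕2` are CLOSED FORMS in
`(d, a, K_R, C_R, C_Q, M_Q)` — no `η`, `L`, `m`, `c₀`, `c₁`, AND NO `k = n+1`.  It is R2′ STEP B7′ (B7′-1)'s quantifier shape for print's `k`-th-step operator,
modulo the tower versions of S2 (`C_Q`: `B9Eq315QTowerLipschitzProfile` §4 supplies a `k`-free `δ_{Q,k}` under geometric level profiles, in the `L²` currency)
and S3 (`C_R`: open; today's tower `R`-letter is ne9-leaf-04's `B9Eq368RLipschitzTowerTwoBackgrounds`, with its constants).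

WHAT IS PROVED (sorry-free; 0 `def`; [folklore] arithmetic on the two gen-84 files; no inequality of the papers asserted).
* private `norm_inv_ofReal_mul_self`, private `theta_le_of_le_one` (leaf-03's `θ`-polynomial bound, re-proved — private upstream).
* **`strong_coercive_of_scaled_letters_tower`** — at ONE lattice∕background∕number of levels, displayed letters in α-currency, `0 ≤ α ≤ min 1 (γ(d,a)∕(2Θ+1))`:
  `(γ(d,a)∕2)·(‖D(1)x‖² + ‖D*(1)x‖² + ‖x‖²) ≤ re⟨x, Δ^{(n+1)}_a(U)x⟩`, `Θ = 5√dK_R + 17dK_R² + √dK_RC_R + 2C_R + C_R² + aC_Q(2M_Q + C_Q)`.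
* **`exists_strong_coercive_of_scaled_letters_tower`** — `∃ α₀ γ′ > 0` (closed forms in `d, a, K_R, C_R, C_Q, M_Q`) BEFORE `∀ L ≥ 1 ∀ n ∀ η (0 < ηL^{n+1} ≤ 1)
  ∀ c₀ c₁ (c₁(ηL^{n+1})² = c₀L^{(n+1)d}) ∀ m ∀ U (tower data, hRS) ∀ α ≤ α₀` with the three displayed letters ⇒ the strong coercivity above.
MODEL ∕ DECLARED READINGS.  (M1)–(M3) exactly as `B9Thm311SmallFieldCoercivityScaled`, one storey up: DISPLAYED `hRS`; transporter closeness `K_R·αη`; the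
`R`-letter `C_R·α` and the `Q`-letters `C_Q·α`, `M_Q` FOR THE `(n+1)`-LEVEL `R_{n+1}`, `Q_{n+1}`.  If the tower S3 delivers only `C_R(η, k)`, this file's `α₀`
inherits exactly that dependence and nothing else.
HONEST SCOPE.  [folklore] threshold arithmetic; «NE9 ⇐ the named binders»; NE9 NOT PRINTED ∕ NOT PROVED; NOT summit progress (cell pub-balaban: row NE9
WALLED ON A MODEL; spine PROVED 0/9; rung (B)+1 finite T⁴ — NOT infinite volume, NOT mass gap, NOT Clay; HONEST DEPENDENCY: continuum YM on T⁴ ⇐ BetaPertH ∧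
nine spine estimates (0/9 proved); BetaPertH ⇐ (D1) ∧ (D4) ∧ CAP+tail; G-an2-4 gates asym, D1 and NE2/3/4).  Filed by the pub-balaban NE9 BINDER-row owner
lineage `b2b-balaban-t4-ne9-p1` (gen 84), INTENT I-ne9p1-g84-5; NEW file importing `B9Eq382FormRelativeNearFlatTower` only; modifies nothing.
Net new unproved facts: 0.
-/

noncomputable section

open scoped InnerProductSpace ComplexConjugate

namespace Literature.MathematicalPhysics.QuantumFieldTheory.Balaban1983to89.B9Thm311SmallFieldCoercivityTowerScaled

open B4Sect5Torus (TSite)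
open B9SectCLatticeCarrier (Bond)
open B9Eq319QprimeTorus (fineP)
open B11Eq103H1Complex (SiteL2K BondL2K covDivL2K laplaceALatticeK)
open B9Eq310HessianOperator (adTransportW principalOpK covCurlL2K)
open B9Eq315QTorus (perCfg cornerSite)
open B9Eq315QTower (towerP UlevOf)
open B9Eq315QTowerFlat (perCfg_UlevOf_one_mem_U1 norm_Wcx_UlevOf_one_sub_one_le)
open B9Eq326OperatorTower (QkW RofUk)
open B7Prop1Explicit (U1 Wcx boxVec)
open B9Eq382FormRelativeNearFlatTower (strong_coercive_of_form_near_flat_tower_canonical)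

/-! ## §1 Arithmetic: `‖(η:ℂ)⁻¹‖·η = 1` and the `θ`-polynomial is `O(α)` on `0 ≤ α ≤ 1` -/

/-- `‖(η : ℂ)⁻¹‖·η = 1` for `η > 0` (the scaled transporter closeness `K_R·αη` times the chain's derivative scale `‖η⁻¹‖` is `K_Rα`). [folklore] -/
private theorem norm_inv_ofReal_mul_self {η : ℝ} (hη : 0 < η) : ‖((η : ℂ))⁻¹‖ * η = 1 := by
  rw [norm_inv, Complex.norm_real, Real.norm_eq_abs, abs_of_pos hη, inv_mul_cancel₀ hη.ne']

/-- The `θ`-polynomial of `B9Eq382FormRelativeNearFlat` §5 at `t = K_Rα`, `δ_R = C_Rα`, `δ_Q = C_Qα` is at most `Θ·α` for `0 ≤ α ≤ 1`,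
`Θ = 5√d·K_R + 17d·K_R² + √d·K_R·C_R + 2C_R + C_R² + a·C_Q·(2M_Q + C_Q)`. [folklore] -/
private theorem theta_le_of_le_one {d : ℕ} {a KR CR CQ MQ α : ℝ} (ha : 0 ≤ a) (hKR : 0 ≤ KR) (hCR : 0 ≤ CR) (hCQ : 0 ≤ CQ)
    (hα : 0 ≤ α) (hα1 : α ≤ 1) :
    4 * Real.sqrt d * (KR * α) + (4 * Real.sqrt d * (KR * α)) ^ 2 + KR * α * Real.sqrt d + KR * α * Real.sqrt d * (CR * α) +
        (KR * α * Real.sqrt d) ^ 2 + 2 * (CR * α) + (CR * α) ^ 2 + a * (CQ * α) * (2 * MQ + CQ * α) ≤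
      (5 * Real.sqrt d * KR + 17 * d * KR ^ 2 + Real.sqrt d * KR * CR + 2 * CR + CR ^ 2 + a * CQ * (2 * MQ + CQ)) * α := by
  have hd : (0 : ℝ) ≤ Real.sqrt d := Real.sqrt_nonneg _
  have hsd : Real.sqrt d * Real.sqrt d = d := Real.mul_self_sqrt (Nat.cast_nonneg d)
  have hα2 : α ^ 2 ≤ α := by nlinarith
  -- every quadratic term `c·α²` is `≤ c·α`
  have h1 : (4 * Real.sqrt d * (KR * α)) ^ 2 + (KR * α * Real.sqrt d) ^ 2 = 17 * d * KR ^ 2 * α ^ 2 := by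
    rw [show (4 * Real.sqrt d * (KR * α)) ^ 2 + (KR * α * Real.sqrt d) ^ 2 = 17 * (Real.sqrt d * Real.sqrt d) * KR ^ 2 * α ^ 2 by ring, hsd]
  have h2 : 17 * d * KR ^ 2 * α ^ 2 ≤ 17 * d * KR ^ 2 * α := mul_le_mul_of_nonneg_left hα2 (by positivity)
  have h3 : KR * α * Real.sqrt d * (CR * α) ≤ Real.sqrt d * KR * CR * α := by
    have : KR * α * Real.sqrt d * (CR * α) = Real.sqrt d * KR * CR * α ^ 2 := by ring
    rw [this]; exact mul_le_mul_of_nonneg_left hα2 (by positivity)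
  have h4 : (CR * α) ^ 2 ≤ CR ^ 2 * α := by
    rw [show (CR * α) ^ 2 = CR ^ 2 * α ^ 2 by ring]; exact mul_le_mul_of_nonneg_left hα2 (by positivity)
  have h5 : a * (CQ * α) * (2 * MQ + CQ * α) ≤ a * CQ * (2 * MQ + CQ) * α := by
    have e : a * (CQ * α) * (2 * MQ + CQ * α) = a * CQ * (2 * MQ) * α + a * CQ * CQ * α ^ 2 := by ring
    have e' : a * CQ * (2 * MQ + CQ) * α = a * CQ * (2 * MQ) * α + a * CQ * CQ * α := by ring
    rw [e, e']
    have := mul_le_mul_of_nonneg_left hα2 (show 0 ≤ a * CQ * CQ by positivity)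
    linarith
  nlinarith [h1, h2, h3, h4, h5, hd, hKR, hα]

/-! ## §2 At one lattice and one background: the strong coercivity under the scaled letters -/

section One

variable {d : ℕ} (L : ℕ) [NeZero L] (m : Fin d → ℕ) [∀ i, NeZero (m i)] (n : ℕ) (hL : 1 ≤ L) {c₀ c₁ : ℝ} [Fact (0 < c₀)] [Fact (0 < c₁)]
  {𝔸 : Type*} [NormedRing 𝔸] [NormedAlgebra ℂ 𝔸] [CompleteSpace 𝔸] [NormOneClass 𝔸]
  {W : Type*} [NormedAddCommGroup W] [InnerProductSpace ℂ W] [FiniteDimensional ℂ W] (φ : W ≃ₗ[ℂ] 𝔸)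
  {η : ℝ} {a : ℝ} (ha : 0 < a) (U : Bond d (towerP L m (n + 1)) → 𝔸ˣ) (αU : ℕ → ℝ) (hα1 : ∀ j, αU j ≤ 1 / 64)
  (hU1 : ∀ (j : ℕ) (x : B7Prop1Explicit.Site d) (κ : Fin d), perCfg (towerP L m (j + 1)) (UlevOf L m (n + 1) U j) x κ ∈ U1 𝔸)
  (hreg : ∀ (j : ℕ) (y : TSite d (towerP L m j)) (κ : Fin d) (r : Fin d → Fin L),
    ‖((Wcx L (perCfg (towerP L m (j + 1)) (UlevOf L m (n + 1) U j)) (cornerSite L y) κ (boxVec L r) : 𝔸ˣ) : 𝔸) - 1‖ ≤ αU j)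
  (hRS : ∀ (b : Bond d (towerP L m (n + 1))) (v u : W), ⟪adTransportW φ U b v, u⟫_ℂ = ⟪v, adTransportW φ (fun b => (U b)⁻¹) b u⟫_ℂ)
  {KR CR CQ MQ α : ℝ} (hKR : 0 ≤ KR) (hCR : 0 ≤ CR) (hCQ : 0 ≤ CQ) (hMQ : 0 ≤ MQ) (hα : 0 ≤ α)
  (hRε : ∀ (b : Bond d (towerP L m (n + 1))) (w : W), ‖adTransportW φ U b w - w‖ ≤ KR * α * η * ‖w‖)
  (hR : ∀ y : SiteL2K ℂ d (towerP L m (n + 1)) c₀ W, ‖RofUk L m n φ η U y - RofUk L m n φ η (fun _ : Bond d (towerP L m (n + 1)) => (1 : 𝔸ˣ)) y‖ ≤ CR * α * ‖y‖)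
  (hQ : ∀ x : BondL2K ℂ d (towerP L m (n + 1)) c₀ W, ‖QkW L m n φ U hL αU hα1 hU1 hreg (c₁ := c₁) x -
    QkW L m n φ (fun _ : Bond d (towerP L m (n + 1)) => (1 : 𝔸ˣ)) hL (fun _ => 0) (fun _ => by norm_num) (perCfg_UlevOf_one_mem_U1 L m (n + 1)) (norm_Wcx_UlevOf_one_sub_one_le L m (n + 1) (fun _ => 0) (fun _ => le_rfl)) (c₁ := c₁) x‖ ≤ CQ * α * ‖x‖)
  (hQ₁ : ∀ x : BondL2K ℂ d (towerP L m (n + 1)) c₀ W,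
    ‖QkW L m n φ (fun _ : Bond d (towerP L m (n + 1)) => (1 : 𝔸ˣ)) hL (fun _ => 0) (fun _ => by norm_num) (perCfg_UlevOf_one_mem_U1 L m (n + 1)) (norm_Wcx_UlevOf_one_sub_one_le L m (n + 1) (fun _ => 0) (fun _ => le_rfl)) (c₁ := c₁) x‖ ≤ MQ * ‖x‖)

include ha hRS hKR hCR hCQ hMQ hα hRε hR hQ hQ₁

/-- **THE STRONG SMALL-FIELD COERCIVITY UNDER THE SCALED LETTERS, ONE LATTICE ∕ ONE BACKGROUND**: along `c₁(ηL)² = c₀L^d`, `0 < ηL ≤ 1`, with the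
transporters `K_R·αη`-close to the identity (print's (3.35) in the chain's letters), the `R`-letter `C_R·α` and the `Q`-letters `C_Q·α`, `M_Q` displayed,
and `α ≤ min 1 (γ(d,a)∕(2Θ + 1))`: `(γ(d,a)∕2)·(‖D(1)x‖² + ‖D*(1)x‖² + ‖x‖²) ≤ re⟨x, (D*D + D R(U) D* + aQ(U)†Q(U)) x⟩`, `γ(d,a) = 1∕((d+1)Cst d a)`
— (S0) + (S1∕S4)'s `strong_coercive_of_form_near_flat_canonical` with `θ ≤ Θα ≤ γ∕2`.  No `η`, `L`, `m`, `c₀`, `c₁` in `Θ` or `γ`.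
[cite: Balaban1985BackgroundPropagators, Thm 3.11 p.416, (3.35) p.396, (3.82)–(3.86) p.407; Balaban1984PropagatorsI, Prop. 1.1 (1.90) p.33] -/
theorem strong_coercive_of_scaled_letters_tower (hηL0 : 0 < η * (L : ℝ) ^ (n + 1)) (hηL1 : η * (L : ℝ) ^ (n + 1) ≤ 1)
    (hs : c₁ * (η * (L : ℝ) ^ (n + 1)) ^ 2 = c₀ * ((L : ℝ) ^ (n + 1)) ^ d) (hα1' : α ≤ 1)
    (hαΘ : α ≤ (1 / ((d + 1 : ℝ) * B5Prop11Plancherel.Cst d a)) /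
      (2 * (5 * Real.sqrt d * KR + 17 * d * KR ^ 2 + Real.sqrt d * KR * CR + 2 * CR + CR ^ 2 + a * CQ * (2 * MQ + CQ)) + 1))
    (x : BondL2K ℂ d (towerP L m (n + 1)) c₀ W) :
    (1 / ((d + 1 : ℝ) * B5Prop11Plancherel.Cst d a)) / 2 *
        (‖covCurlL2K ℂ c₀ ((η : ℂ))⁻¹ (adTransportW φ (fun _ : Bond d (towerP L m (n + 1)) => (1 : 𝔸ˣ))) x‖ ^ 2 +
          ‖covDivL2K ℂ c₀ ((η : ℂ))⁻¹ (adTransportW φ fun _ : Bond d (towerP L m (n + 1)) => (1 : 𝔸ˣ)⁻¹) x‖ ^ 2 + ‖x‖ ^ 2) ≤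
      RCLike.re ⟪x, laplaceALatticeK ((η : ℂ))⁻¹ (adTransportW φ U) (adTransportW φ fun b => (U b)⁻¹) (principalOpK φ η U) (RofUk L m n φ η U)
        (QkW L m n φ U hL αU hα1 hU1 hreg (c₁ := c₁)) a x⟫_ℂ := by
  have hL0 : (0 : ℝ) < L := by exact_mod_cast Nat.pos_of_ne_zero (NeZero.ne L)
  have hLr : (0 : ℝ) < (L : ℝ) ^ (n + 1) := by positivity
  have hη : 0 < η := pos_of_mul_pos_left hηL0 hLr.le
  have hεR : 0 ≤ KR * α * η := by positivity
  have h := strong_coercive_of_form_near_flat_tower_canonical L m n hL φ (c₁ := c₁) ha U αU hα1 hU1 hreg hRS hεR (by positivity : 0 ≤ CR * α)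
    (by positivity : 0 ≤ CQ * α) hMQ hRε hR hQ hQ₁ hηL0 hηL1 hs x
  -- `‖η⁻¹‖·(K_Rαη) = K_Rα`
  have ht : ‖((η : ℂ))⁻¹‖ * (KR * α * η) = KR * α := by
    rw [show ‖((η : ℂ))⁻¹‖ * (KR * α * η) = KR * α * (‖((η : ℂ))⁻¹‖ * η) by ring, norm_inv_ofReal_mul_self hη, mul_one]
  rw [ht] at h
  -- `θ ≤ Θ·α ≤ γ∕2`
  set γ : ℝ := 1 / ((d + 1 : ℝ) * B5Prop11Plancherel.Cst d a) with hγ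
  set Θ : ℝ := 5 * Real.sqrt d * KR + 17 * d * KR ^ 2 + Real.sqrt d * KR * CR + 2 * CR + CR ^ 2 + a * CQ * (2 * MQ + CQ) with hΘ
  have hC : (1 : ℝ) ≤ B5Prop11Plancherel.Cst d a := B5Prop11Lower.one_le_Cst _
  have hγ0 : 0 < γ := by rw [hγ]; positivity
  have hΘ0 : 0 ≤ Θ := by rw [hΘ]; positivity
  have hθ := theta_le_of_le_one (d := d) (MQ := MQ) ha.le hKR hCR hCQ hα hα1'
  have hΘα : Θ * α ≤ γ / 2 := by
    have h1 : Θ * α ≤ Θ * (γ / (2 * Θ + 1)) := mul_le_mul_of_nonneg_left hαΘ hΘ0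
    have h2 : Θ * (γ / (2 * Θ + 1)) ≤ γ / 2 := by
      rw [mul_div_assoc', div_le_div_iff₀ (by positivity) (by norm_num)]
      nlinarith
    exact h1.trans h2
  have hN : 0 ≤ ‖covCurlL2K ℂ c₀ ((η : ℂ))⁻¹ (adTransportW φ (fun _ : Bond d (towerP L m (n + 1)) => (1 : 𝔸ˣ))) x‖ ^ 2 +
      ‖covDivL2K ℂ c₀ ((η : ℂ))⁻¹ (adTransportW φ fun _ : Bond d (towerP L m (n + 1)) => (1 : 𝔸ˣ)⁻¹) x‖ ^ 2 + ‖x‖ ^ 2 := by positivity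
  refine le_trans ?_ h
  refine mul_le_mul_of_nonneg_right ?_ hN
  rw [← hΘ] at hθ
  linarith

end One

/-! ## §3 `∃ α₀ γ′` BEFORE `∀ L ∀ η ∀ c₀ c₁ ∀ m ∀ U` — B7′-1's quantifier shape, modulo the two displayed letters -/

section Exists

variable {d : ℕ} {𝔸 : Type*} [NormedRing 𝔸] [NormedAlgebra ℂ 𝔸] [CompleteSpace 𝔸] [NormOneClass 𝔸]
  {W : Type*} [NormedAddCommGroup W] [InnerProductSpace ℂ W] [FiniteDimensional ℂ W] (φ : W ≃ₗ[ℂ] 𝔸)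
  {a : ℝ} (ha : 0 < a) {KR CR CQ MQ : ℝ} (hKR : 0 ≤ KR) (hCR : 0 ≤ CR) (hCQ : 0 ≤ CQ) (hMQ : 0 ≤ MQ)

include ha hKR hCR hCQ hMQ

/-- **[B9] THM 3.11's SECOND HALF, STRONG AND SPACING∕VOLUME∕BLOCK-FREE, MODULO THE `R`- AND `Q`-LETTERS IN α-CURRENCY** — there are
`α₀ = min 1 (γ(d,a)∕(2Θ+1))` and `γ′ = γ(d,a)∕2`, closed forms in `(d, a, K_R, C_R, C_Q, M_Q)`, such that for EVERY block size `L ≥ 1`, spacing with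
`0 < ηL ≤ 1`, weights in print's relation `c₁(ηL)² = c₀L^d`, volume `m`, background `U` of E162's data with `hRS`, and `0 ≤ α ≤ α₀`: transporters
`K_R·αη`-close to the identity, `‖(R(U) − R(1))y‖ ≤ C_Rα‖y‖`, `‖(Q(U) − Q(1))x‖ ≤ C_Qα‖x‖`, `‖Q(1)x‖ ≤ M_Q‖x‖` ⇒
`γ′·(‖D(1)x‖² + ‖D*(1)x‖² + ‖x‖²) ≤ re⟨x, Δ_a(U)x⟩`.  The shape ROUTES-NE9 v13.19 B7′ names for its S4 target, with S2∕S3's outputs as binders.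
[cite: Balaban1985BackgroundPropagators, Thm 3.11 p.416, (3.35) p.396, (3.82)–(3.86) p.407; Balaban1984PropagatorsI, Prop. 1.1 (1.90) p.33] -/
theorem exists_strong_coercive_of_scaled_letters_tower :
    ∃ α₀ γ' : ℝ, 0 < α₀ ∧ 0 < γ' ∧ ∀ (L : ℕ) [NeZero L] (hL : 1 ≤ L) (n : ℕ) (η : ℝ), 0 < η * (L : ℝ) ^ (n + 1) → η * (L : ℝ) ^ (n + 1) ≤ 1 →
      ∀ (c₀ c₁ : ℝ) [Fact (0 < c₀)] [Fact (0 < c₁)], c₁ * (η * (L : ℝ) ^ (n + 1)) ^ 2 = c₀ * ((L : ℝ) ^ (n + 1)) ^ d →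
      ∀ (m : Fin d → ℕ) [∀ i, NeZero (m i)] (U : Bond d (towerP L m (n + 1)) → 𝔸ˣ) (αU : ℕ → ℝ) (hα1 : ∀ j, αU j ≤ 1 / 64)
        (hU1 : ∀ (j : ℕ) (x : B7Prop1Explicit.Site d) (κ : Fin d), perCfg (towerP L m (j + 1)) (UlevOf L m (n + 1) U j) x κ ∈ U1 𝔸)
        (hreg : ∀ (j : ℕ) (y : TSite d (towerP L m j)) (κ : Fin d) (r : Fin d → Fin L),
          ‖((Wcx L (perCfg (towerP L m (j + 1)) (UlevOf L m (n + 1) U j)) (cornerSite L y) κ (boxVec L r) : 𝔸ˣ) : 𝔸) - 1‖ ≤ αU j) {α : ℝ}, 0 ≤ α → α ≤ α₀ →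
        (∀ (b : Bond d (towerP L m (n + 1))) (v u : W), ⟪adTransportW φ U b v, u⟫_ℂ = ⟪v, adTransportW φ (fun b => (U b)⁻¹) b u⟫_ℂ) →
        (∀ (b : Bond d (towerP L m (n + 1))) (w : W), ‖adTransportW φ U b w - w‖ ≤ KR * α * η * ‖w‖) →
        (∀ y : SiteL2K ℂ d (towerP L m (n + 1)) c₀ W, ‖RofUk L m n φ η U y - RofUk L m n φ η (fun _ : Bond d (towerP L m (n + 1)) => (1 : 𝔸ˣ)) y‖ ≤ CR * α * ‖y‖) →
        (∀ x : BondL2K ℂ d (towerP L m (n + 1)) c₀ W, ‖QkW L m n φ U hL αU hα1 hU1 hreg (c₁ := c₁) x -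
          QkW L m n φ (fun _ : Bond d (towerP L m (n + 1)) => (1 : 𝔸ˣ)) hL (fun _ => 0) (fun _ => by norm_num) (perCfg_UlevOf_one_mem_U1 L m (n + 1)) (norm_Wcx_UlevOf_one_sub_one_le L m (n + 1) (fun _ => 0) (fun _ => le_rfl)) (c₁ := c₁) x‖ ≤ CQ * α * ‖x‖) →
        (∀ x : BondL2K ℂ d (towerP L m (n + 1)) c₀ W,
          ‖QkW L m n φ (fun _ : Bond d (towerP L m (n + 1)) => (1 : 𝔸ˣ)) hL (fun _ => 0) (fun _ => by norm_num) (perCfg_UlevOf_one_mem_U1 L m (n + 1)) (norm_Wcx_UlevOf_one_sub_one_le L m (n + 1) (fun _ => 0) (fun _ => le_rfl)) (c₁ := c₁) x‖ ≤ MQ * ‖x‖) →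
        ∀ x : BondL2K ℂ d (towerP L m (n + 1)) c₀ W,
          γ' * (‖covCurlL2K ℂ c₀ ((η : ℂ))⁻¹ (adTransportW φ (fun _ : Bond d (towerP L m (n + 1)) => (1 : 𝔸ˣ))) x‖ ^ 2 +
              ‖covDivL2K ℂ c₀ ((η : ℂ))⁻¹ (adTransportW φ fun _ : Bond d (towerP L m (n + 1)) => (1 : 𝔸ˣ)⁻¹) x‖ ^ 2 + ‖x‖ ^ 2) ≤
            RCLike.re ⟪x, laplaceALatticeK ((η : ℂ))⁻¹ (adTransportW φ U) (adTransportW φ fun b => (U b)⁻¹) (principalOpK φ η U)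
              (RofUk L m n φ η U) (QkW L m n φ U hL αU hα1 hU1 hreg (c₁ := c₁)) a x⟫_ℂ := by
  have hC : (1 : ℝ) ≤ B5Prop11Plancherel.Cst d a := B5Prop11Lower.one_le_Cst _
  have hΘ0 : 0 ≤ 5 * Real.sqrt d * KR + 17 * d * KR ^ 2 + Real.sqrt d * KR * CR + 2 * CR + CR ^ 2 + a * CQ * (2 * MQ + CQ) := by positivity
  refine ⟨min 1 ((1 / ((d + 1 : ℝ) * B5Prop11Plancherel.Cst d a)) /
      (2 * (5 * Real.sqrt d * KR + 17 * d * KR ^ 2 + Real.sqrt d * KR * CR + 2 * CR + CR ^ 2 + a * CQ * (2 * MQ + CQ)) + 1)),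
    (1 / ((d + 1 : ℝ) * B5Prop11Plancherel.Cst d a)) / 2, lt_min one_pos (by positivity), by positivity, ?_⟩
  intro L _ hL n η hηL0 hηL1 c₀ c₁ _ _ hs m _ U αU hα1 hU1 hreg α hα0 hαle hRS hRε hR hQ hQ₁ x
  exact strong_coercive_of_scaled_letters_tower L m n hL φ (c₁ := c₁) ha U αU hα1 hU1 hreg hRS hKR hCR hCQ hMQ hα0 hRε hR hQ hQ₁ hηL0 hηL1 hs
    (hαle.trans (min_le_left _ _)) (hαle.trans (min_le_right _ _)) x

end Exists

end Literature.MathematicalPhysics.QuantumFieldTheory.Balaban1983to89.B9Thm311SmallFieldCoercivityTowerScaled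

end
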